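import Mathlib.LinearAlgebra.Matrix.Permanent
import Mathlib.Logic.Equiv.Fin.Basic
import Mathlib.Algebra.BigOperators.Fin
import Mathlib.Algebra.BigOperators.Intervals
import Mathlib.Algebra.Ring.GeomSum
import Literature.LinearAlgebra.Matrix.PermanentLaplace
import Literature.LinearAlgebra.Matrix.PermanentSubperm
import HarnessLib

/-!
# Bypass nodes and weight gadgets for the permanent (Valiant's reduction to `0/1` matrices)

Read a square matrix `A` over a commutative semiring as a weighted digraph; `per A` is the sum
over cycle covers of the products of the weights (Valiant 1979, proof of Lemma 3.1). Valiant's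
Lemma 3.3 (*The complexity of computing the permanent*, TCS 8 (1979), p. 193 and pp. 196–197)
replaces an edge of weight `k` by a small subgraph of weight-`1` edges and self-loops without
changing the permanent ("if `(x, y)` is not covered by a cycle in `A` then there is just one way
to cover the new nodes; if it is covered, there are `k` ways"). This file proves the algebra
behind such replacements once and for all, in matrix language and over any commutative semiring:

* `Matrix.permanent_updateCol_add` — the permanent is additive in each column (Mathlib has the
  homogeneity `Matrix.permanent_updateCol_smul` only);
* `Matrix.permanent_bypass` — **one bypass node**: if the last index `⋆` of a matrix on
  `V ⊕ Unit` carries a self-loop of weight `1` and its row is otherwise supported in the single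
  column `v`, with `B ⋆ v = b`, then `per B = per (A with column v replaced by A·v + b · a)`, where
  `A` is the `V`-block and `a` the column of `⋆` (Laplace expansion along the row of `⋆`, then
  column additivity);
* `Matrix.permanent_dag` — **a single-sink DAG of bypass nodes**: on `V ⊕ Fin m`, if every new
  node has a unit self-loop, no edge to a new node of smaller index and no edge to an old column
  other than `v`, then `per B = per (A with column v ↦ A·v + ∑ₓ w x · aₓ)`, where `aₓ` is the
  column of the new node `x` restricted to `V` and the weights `w` solve the backward recursion
  `w x = B x v + ∑_{x' > x} B x x' · w x'` (number of weighted paths from `x` to `v`); proved by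
  peeling the last node with `permanent_bypass`;
* `Matrix.slotGadget`, `Matrix.permanent_slotGadget` — the **transitive tournament** on the
  first `act` of `K` new nodes, entered from `u` at node `0` and leaving to `v` from every active
  node: it adds `2^(act-1)` to the entry `(u, v)` (`act = 0`: nothing) with `act` new nodes and
  `0/1` weights only (Valiant's chain of Fig. 2 realises weight `k` with `O(k)` nodes; the
  tournament realises `2^(act-1)` with `act` nodes, which is what the single-modulus variant of
  the reduction — `-1 ≡ 2^q (mod 2^q + 1)`, Papadimitriou 1994, proof of Thm. 18.3 — needs);
* `Matrix.multiSlot`, `Matrix.permanent_multiSlot` — any family of such gadgets attached to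
  slots `(u_s, v_s, act_s)` simultaneously (index `V ⊕ Fin k × Fin K`): the permanent is that of
  `A + ∑_s 2^(act_s - 1) · E_{u_s v_s}` (peel one slot at a time).

The lemmas taking a matrix argument (`permanent_updateCol_add(_smul)`, `permanent_bypass`,
`permanent_dag`, `slotGadget`/`permanent_slotGadget`, `multiSlot`/`addSlots`/`permanent_multiSlot`)
are deliberate dot-notation extensions of Mathlib's `Matrix` namespace (general facts about
`Matrix.permanent`); the index plumbing (`bypassCol`, `dagPeel`, `slotPeel`), the weights
(`slotWeight`, `slotW`, `sum_slotW_add_one`) and the record `Slot` live in the path namespace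
`Literature.LinearAlgebra.Matrix`. Prior art in the tree: `Matrix.permanent_seriesAt`
(`Computability/AlgebraicComplexity/ValiantKitBlocks.lean`) is the special case of
`permanent_bypass` with a single entering edge over a commutative ring.

## References

* L. G. Valiant, *The complexity of computing the permanent*, Theoret. Comput. Sci. 8 (1979)
  189–201: Lemma 3.3 and its proof (pp. 193, 196–197), Fig. 2.
* C. H. Papadimitriou, *Computational Complexity*, Addison-Wesley 1994, Thm. 18.3 and its proof
  (weights `2^k` by chains of gadgets, arithmetic modulo `2^n + 1`).
-/

namespace Literature.LinearAlgebra.Matrix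

open Equiv Finset

/-! ### Index plumbing and weights (path namespace) -/

section HelpersDec

variable {V : Type*} [DecidableEq V]

/-- The column map of the bypass lemma: the old columns, with the column `v` redirected to the
new node `⋆`. [folklore] -/
def bypassCol (v : V) (c : V) : V ⊕ Unit :=
  if c = v then Sum.inr () else Sum.inl c

/-- `bypassCol v` is injective. [folklore] -/
theorem bypassCol_injective (v : V) : Function.Injective (bypassCol v) := by
  intro c c' h
  unfold bypassCol at h
  by_cases hc : c = v <;> by_cases hc' : c' = v
  · exact hc.trans hc'.symm
  · rw [if_pos hc, if_neg hc'] at h; exact absurd h Sum.inr_ne_inl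
  · rw [if_neg hc, if_pos hc'] at h; exact absurd h Sum.inl_ne_inr
  · rw [if_neg hc, if_neg hc'] at h; exact Sum.inl_injective h

/-- The range of `bypassCol v` is everything but the old column `v`. [folklore] -/
theorem mem_range_bypassCol_iff (v : V) (i : V ⊕ Unit) :
    i ∈ Set.range (bypassCol v) ↔ i ≠ Sum.inl v := by
  constructor
  · rintro ⟨c, rfl⟩ h
    unfold bypassCol at h
    by_cases hc : c = v
    · rw [if_pos hc] at h; exact Sum.inr_ne_inl h
    · rw [if_neg hc] at h; exact hc (Sum.inl_injective h)
  · intro hi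
    rcases i with c | u
    · refine ⟨c, ?_⟩
      have hc : c ≠ v := fun h => hi (by rw [h])
      simp [bypassCol, hc]
    · exact ⟨v, by simp [bypassCol]⟩

end HelpersDec

section Helpers

variable {R : Type*} [CommSemiring R] {V : Type*}

/-- Re-indexing used to peel the last new node: `(V ⊕ Fin m) ⊕ Unit ≃ V ⊕ Fin (m + 1)`
(old indices kept, `Fin m` embedded by `castSucc`, the extra point sent to `Fin.last m`). [folklore] -/
def dagPeel (V : Type*) (m : ℕ) : (V ⊕ Fin m) ⊕ Unit ≃ V ⊕ Fin (m + 1) :=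
  (Equiv.sumAssoc V (Fin m) Unit).trans
    (Equiv.sumCongr (Equiv.refl V)
      ((Equiv.sumCongr (Equiv.refl (Fin m)) finOneEquiv.symm).trans finSumFinEquiv))

/-- `dagPeel` keeps old indices. [folklore] -/
@[simp] theorem dagPeel_inl_inl (m : ℕ) (r : V) :
    dagPeel V m (Sum.inl (Sum.inl r)) = Sum.inl r := rfl

/-- `dagPeel` embeds the first `m` new nodes by `castSucc`. [folklore] -/
@[simp] theorem dagPeel_inl_inr (m : ℕ) (x : Fin m) :
    dagPeel V m (Sum.inl (Sum.inr x)) = Sum.inr (Fin.castSucc x) := rfl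

/-- `dagPeel` sends the extra point to the last new node. [folklore] -/
@[simp] theorem dagPeel_inr (m : ℕ) :
    dagPeel V m (Sum.inr ()) = Sum.inr (Fin.last m) := by
  simp only [dagPeel, Equiv.trans_apply, Equiv.sumAssoc_apply_inr, Equiv.sumCongr_apply,
    Sum.map_inr, finSumFinEquiv_apply_right]
  congr 1

/-- The weight realised by a tournament on `act` active nodes: `2^(act-1)`, and `0` for
`act = 0`. [folklore] -/
def slotWeight (R : Type*) [CommSemiring R] (act : ℕ) : R :=
  if act = 0 then 0 else 2 ^ (act - 1)

/-- The path weights of the tournament: `2^(act-1-x)` for an active node `x`, `0` otherwise. [folklore] -/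
def slotW (R : Type*) [CommSemiring R] (act : ℕ) {K : ℕ} (x : Fin K) : R :=
  if (x : ℕ) < act then 2 ^ (act - 1 - x) else 0

/-- The geometric identity behind the tournament: for an active node `x`,
`∑_{x < x' < act} 2^(act-1-x') + 1 = 2^(act-1-x)`. [folklore] -/
theorem sum_slotW_add_one {K act : ℕ} (hact : act ≤ K) (x : Fin K) (hx : (x : ℕ) < act) :
    ∑ x' : Fin K, (if x < x' ∧ (x' : ℕ) < act then (2 : R) ^ (act - 1 - x') else 0) + 1 =
      2 ^ (act - 1 - x) := by
  have hsum : (∑ x' : Fin K, (if x < x' ∧ (x' : ℕ) < act then (2 : R) ^ (act - 1 - x') else 0)) =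
      ∑ i ∈ Finset.range K, (if (x : ℕ) < i ∧ i < act then (2 : R) ^ (act - 1 - i) else 0) :=
    Fin.sum_univ_eq_sum_range (fun i => if (x : ℕ) < i ∧ i < act then (2 : R) ^ (act - 1 - i) else 0) K
  rw [hsum, ← Finset.sum_filter]
  have hfilter : (Finset.range K).filter (fun i => (x : ℕ) < i ∧ i < act) = Finset.Ico ((x : ℕ) + 1) act := by
    ext i
    simp only [Finset.mem_filter, Finset.mem_range, Finset.mem_Ico]
    omega
  rw [hfilter]
  have hrefl := Finset.sum_Ico_reflect (fun j => (2 : R) ^ j) ((x : ℕ) + 1) (m := act) (n := act - 1) (by omega)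
  have h1 : act - 1 + 1 - act = 0 := by omega
  have h2 : act - 1 + 1 - ((x : ℕ) + 1) = act - 1 - x := by omega
  rw [h1, h2, ← Finset.range_eq_Ico] at hrefl
  rw [hrefl]
  simpa [one_add_one_eq_two] using geom_sum_mul_add (1 : R) (act - 1 - x)

/-- A slot: the entry `(u, v)` to be modified and the number of active gadget nodes. [folklore] -/
structure Slot (V : Type*) where
  /-- the row of the entry -/
  u : V
  /-- the column of the entry -/
  v : V
  /-- the number of active tournament nodes (`0` = inert gadget) -/
  act : ℕ

/-- Re-indexing used to peel the last slot:
`(V ⊕ Fin k × Fin K) ⊕ Fin K ≃ V ⊕ Fin (k + 1) × Fin K`. [folklore] -/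
def slotPeel (V : Type*) (k K : ℕ) : (V ⊕ Fin k × Fin K) ⊕ Fin K ≃ V ⊕ Fin (k + 1) × Fin K where
  toFun
    | Sum.inl (Sum.inl r) => Sum.inl r
    | Sum.inl (Sum.inr (s, x)) => Sum.inr (Fin.castSucc s, x)
    | Sum.inr x => Sum.inr (Fin.last k, x)
  invFun
    | Sum.inl r => Sum.inl (Sum.inl r)
    | Sum.inr (s, x) => Fin.lastCases (Sum.inr x) (fun s' => Sum.inl (Sum.inr (s', x))) s
  left_inv i := by
    rcases i with (r | ⟨s, x⟩) | x
    · rfl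
    · simp
    · simp
  right_inv j := by
    rcases j with r | ⟨s, x⟩
    · rfl
    · induction s using Fin.lastCases with
      | last => simp
      | cast s => simp

/-- `slotPeel` keeps old indices. [folklore] -/
@[simp] theorem slotPeel_inl_inl (k K : ℕ) (r : V) :
    slotPeel V k K (Sum.inl (Sum.inl r)) = Sum.inl r := rfl

/-- `slotPeel` embeds the first `k` slots by `castSucc`. [folklore] -/
@[simp] theorem slotPeel_inl_inr (k K : ℕ) (s : Fin k) (x : Fin K) :
    slotPeel V k K (Sum.inl (Sum.inr (s, x))) = Sum.inr (Fin.castSucc s, x) := rfl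

/-- `slotPeel` sends the extra gadget to the last slot. [folklore] -/
@[simp] theorem slotPeel_inr (k K : ℕ) (x : Fin K) :
    slotPeel V k K (Sum.inr x) = Sum.inr (Fin.last k, x) := rfl

end Helpers

end Literature.LinearAlgebra.Matrix

namespace Matrix

open Equiv Finset Literature.LinearAlgebra.Matrix

variable {R : Type*} [CommSemiring R]

/-! ### Additivity of the permanent in a column -/

section Additive

variable {n : Type*} [Fintype n] [DecidableEq n]

/-- **The permanent is additive in each column**: `per (M with column j ↦ u + v) =
per (M with column j ↦ u) + per (M with column j ↦ v)` (split each product at the factor from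
column `j`). Companion of Mathlib's `Matrix.permanent_updateCol_smul`. [folklore] -/
theorem permanent_updateCol_add (M : Matrix n n R) (j : n) (u v : n → R) :
    permanent (M.updateCol j (u + v)) =
      permanent (M.updateCol j u) + permanent (M.updateCol j v) := by
  unfold permanent
  rw [← Finset.sum_add_distrib]
  refine Finset.sum_congr rfl fun σ _ => ?_
  have h : ∀ w : n → R, ∏ i, (M.updateCol j w) (σ i) i = w (σ j) * ∏ i ∈ univ.erase j, M (σ i) i := by
    intro w
    rw [← Finset.mul_prod_erase _ _ (Finset.mem_univ j), updateCol_self]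
    congr 1
    exact Finset.prod_congr rfl fun i hi => by rw [updateCol_ne (Finset.ne_of_mem_erase hi)]
  rw [h, h, h, Pi.add_apply, add_mul]

/-- The permanent of a matrix with a column replaced by `c + b • a` (the shape produced by a
bypass node). [folklore] -/
theorem permanent_updateCol_add_smul (M : Matrix n n R) (j : n) (b : R) (a : n → R) :
    permanent (M.updateCol j (fun r => M r j + b * a r)) =
      permanent M + b * permanent (M.updateCol j a) := by
  have : (fun r => M r j + b * a r) = (fun r => M r j) + b • a := by
    ext r; simp [smul_eq_mul]
  rw [this, permanent_updateCol_add, updateCol_eq_self, permanent_updateCol_smul]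

end Additive

/-! ### One bypass node -/

section Bypass

variable {V : Type*} [Fintype V] [DecidableEq V]

/-- **One bypass node.** Let `B` be a matrix on `V ⊕ Unit` whose last index `⋆ = inr ()` has a
self-loop of weight `1` and whose row is otherwise supported in the single old column `v`, with
`B ⋆ v = b`. Then `per B = per (A with column v ↦ A·v + b · a)` where `A` is the `V`-block of `B`
and `a = B · ⋆` its last column: a cycle cover either uses the self-loop at `⋆` (contributing
`per A`) or passes `r → ⋆ → v` for exactly one `r` (contributing `b · a r` in place of `A r v`).
Matrix form of Valiant's "there is just one way to cover the new node / the chain must be used"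
(Valiant 1979, proof of Lemma 3.3, p. 196). [cite: Valiant1979, Lemma 3.3 (proof, p. 196)] -/
theorem permanent_bypass (B : Matrix (V ⊕ Unit) (V ⊕ Unit) R) (v : V)
    (hdiag : B (Sum.inr ()) (Sum.inr ()) = 1)
    (hrow : ∀ c : V, c ≠ v → B (Sum.inr ()) (Sum.inl c) = 0) :
    B.permanent = ((B.submatrix Sum.inl Sum.inl).updateCol v
      (fun r => B (Sum.inl r) (Sum.inl v) +
        B (Sum.inr ()) (Sum.inl v) * B (Sum.inl r) (Sum.inr ()))).permanent := by
  classical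
  have hrhs : ((B.submatrix Sum.inl Sum.inl).updateCol v (fun r => B (Sum.inl r) (Sum.inl v) +
        B (Sum.inr ()) (Sum.inl v) * B (Sum.inl r) (Sum.inr ()))).permanent =
      (B.submatrix Sum.inl Sum.inl).permanent + B (Sum.inr ()) (Sum.inl v) *
        ((B.submatrix Sum.inl Sum.inl).updateCol v (fun r => B (Sum.inl r) (Sum.inr ()))).permanent :=
    permanent_updateCol_add_smul (B.submatrix Sum.inl Sum.inl) v _ _
  rw [hrhs]
  have hne : (Sum.inr () : V ⊕ Unit) ≠ Sum.inl v := Sum.inr_ne_inl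
  rw [← B.subperm_true,
    B.subperm_expand_row_support (p := fun _ => True) (q := fun _ => True) (Sum.inr ()) trivial
      {Sum.inr (), Sum.inl v} (fun i _ hi => by
        rcases i with c | u
        · exact hrow c (fun h => hi (by simp [h]))
        · exact absurd (by simp) hi),
    Finset.filter_true, Finset.sum_pair hne, hdiag, one_mul]
  congr 1
  · -- the self-loop term: the `V`-block
    rw [B.subperm_congr (p' := (· ∈ Set.range (Sum.inl : V → V ⊕ Unit)))
        (q' := (· ∈ Set.range (Sum.inl : V → V ⊕ Unit)))
        (fun i => by rcases i with c | u <;> simp) (fun j => by rcases j with c | u <;> simp),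
      B.subperm_range_eq_permanent Sum.inl Sum.inl Sum.inl_injective Sum.inl_injective]
    rfl
  · -- the term through `⋆`: columns `≠ v` and the column of `⋆`
    congr 1
    rw [B.subperm_congr (p' := (· ∈ Set.range (bypassCol v)))
        (q' := (· ∈ Set.range (Sum.inl : V → V ⊕ Unit)))
        (fun i => by rw [mem_range_bypassCol_iff]; simp) (fun j => by rcases j with c | u <;> simp),
      B.subperm_range_eq_permanent (bypassCol v) Sum.inl (bypassCol_injective v) Sum.inl_injective]
    congr 1
    ext a c
    simp only [of_apply, bypassCol, updateCol_apply, submatrix_apply]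
    split_ifs <;> rfl

end Bypass

/-! ### A single-sink DAG of bypass nodes -/

section Dag

variable {V : Type*} [Fintype V] [DecidableEq V]

/-- **A single-sink DAG of bypass nodes.** Let `B` be a matrix on `V ⊕ Fin m` such that every new
node `x` has a self-loop of weight `1` (`h1`), no edge to a new node of smaller index (`h2`) and
no edge to an old column other than `v` (`h3`), and let `w` solve the backward recursion
`w x = B x v + ∑_{x' > x} B x x' · w x'` (`hw`; `w x` is the total weight of the paths from `x` to
`v` through new nodes). Then `per B = per (A with column v ↦ A·v + ∑ₓ w x · B · x)`, `A` the
`V`-block: in a cycle cover the new nodes off their self-loops form one path `r → x → ⋯ → v`,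
of total weight `∑ₓ B r x · w x` in place of `A r v`. (Valiant 1979, proof of Lemma 3.3: "if
`(x, y)` is covered by a cycle in `A` then so must be the chain of new edges from `x` to `y`".)
Proof: peel the last node with `permanent_bypass` and induct. [cite: Valiant1979, Lemma 3.3 (proof, pp. 196–197)] -/
theorem permanent_dag : ∀ (m : ℕ) (B : Matrix (V ⊕ Fin m) (V ⊕ Fin m) R) (v : V) (w : Fin m → R),
    (∀ x, B (Sum.inr x) (Sum.inr x) = 1) →
    (∀ x x', x' < x → B (Sum.inr x) (Sum.inr x') = 0) →
    (∀ x (c : V), c ≠ v → B (Sum.inr x) (Sum.inl c) = 0) →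
    (∀ x, w x = B (Sum.inr x) (Sum.inl v) +
      ∑ x', if x < x' then B (Sum.inr x) (Sum.inr x') * w x' else 0) →
    B.permanent = ((B.submatrix Sum.inl Sum.inl).updateCol v
      (fun r => B (Sum.inl r) (Sum.inl v) + ∑ x, B (Sum.inl r) (Sum.inr x) * w x)).permanent
  | 0, B, v, w, _, _, _, _ => by
    rw [← permanent_submatrix_equiv (Equiv.sumEmpty V (Fin 0)).symm B]
    congr 1
    ext r c
    simp only [submatrix_apply, Equiv.sumEmpty_symm_apply, updateCol_apply, Finset.univ_eq_empty,
      Finset.sum_empty, add_zero]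
    split_ifs with h
    · rw [h]
    · rfl
  | m + 1, B, v, w, h1, h2, h3, hw => by
    -- the weight of the last node is its edge to `v`
    have hwlast : w (Fin.last m) = B (Sum.inr (Fin.last m)) (Sum.inl v) := by
      rw [hw (Fin.last m), Finset.sum_eq_zero (fun x' _ => if_neg (not_lt_of_ge (Fin.le_last x'))),
        add_zero]
    -- re-index and peel the last node
    set e := dagPeel V m with he
    rw [← permanent_submatrix_equiv e B,
      permanent_bypass (B.submatrix e e) (Sum.inl v) (by simp [he, h1]) (by
        rintro (c | x) hc
        · simp only [submatrix_apply, he, dagPeel_inr, dagPeel_inl_inl]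
          exact h3 _ _ (fun h => hc (by rw [h]))
        · simp only [submatrix_apply, he, dagPeel_inr, dagPeel_inl_inr]
          exact h2 _ _ (Fin.castSucc_lt_last x))]
    -- the peeled matrix on `V ⊕ Fin m`
    set b := B (Sum.inr (Fin.last m)) (Sum.inl v) with hb
    set B₁ : Matrix (V ⊕ Fin m) (V ⊕ Fin m) R :=
      ((B.submatrix e e).submatrix Sum.inl Sum.inl).updateCol (Sum.inl v)
        (fun r' => (B.submatrix e e) (Sum.inl r') (Sum.inl (Sum.inl v)) +
          (B.submatrix e e) (Sum.inr ()) (Sum.inl (Sum.inl v)) *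
            (B.submatrix e e) (Sum.inl r') (Sum.inr ())) with hB₁
    have hB₁v : ∀ i, B₁ i (Sum.inl v) =
        B (e (Sum.inl i)) (Sum.inl v) + b * B (e (Sum.inl i)) (Sum.inr (Fin.last m)) := by
      intro i
      simp only [hB₁, updateCol_self, submatrix_apply, he, dagPeel_inl_inl, dagPeel_inr, hb]
    have hB₁ne : ∀ i j, j ≠ Sum.inl v → B₁ i j = B (e (Sum.inl i)) (e (Sum.inl j)) := by
      intro i j hj
      simp only [hB₁, updateCol_ne hj, submatrix_apply]
    -- it satisfies the hypotheses, with the restricted weights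
    have IH := permanent_dag m B₁ v (fun x => w (Fin.castSucc x))
      (fun x => by rw [hB₁ne _ _ Sum.inr_ne_inl]; simp [he, h1])
      (fun x x' hx => by
        rw [hB₁ne _ _ Sum.inr_ne_inl]
        simpa [he] using h2 _ _ (Fin.castSucc_lt_castSucc_iff.2 hx))
      (fun x c hc => by
        rw [hB₁ne _ _ (fun h => hc (Sum.inl_injective h))]
        simpa [he] using h3 _ _ hc)
      (fun x => by
        rw [hw (Fin.castSucc x), Fin.sum_univ_castSucc, if_pos (Fin.castSucc_lt_last x), hwlast,
          hB₁v]
        simp only [he, dagPeel_inl_inr]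
        rw [Finset.sum_congr rfl fun x' _ => show
          (if Fin.castSucc x < Fin.castSucc x' then
              B (Sum.inr (Fin.castSucc x)) (Sum.inr (Fin.castSucc x')) * w (Fin.castSucc x') else 0) =
            if x < x' then B₁ (Sum.inr x) (Sum.inr x') * w (Fin.castSucc x') else 0 by
          rw [hB₁ne _ _ Sum.inr_ne_inl]
          simp only [Fin.castSucc_lt_castSucc_iff, he, dagPeel_inl_inr]]
        rw [hb]; ring)
    rw [IH]
    congr 1
    ext r c
    simp only [updateCol_apply, submatrix_apply]
    split_ifs with hc
    · subst hc
      rw [hB₁v, Fin.sum_univ_castSucc, hwlast,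
        Finset.sum_congr rfl fun x _ => show B₁ (Sum.inl r) (Sum.inr x) * w (Fin.castSucc x) =
          B (Sum.inl r) (Sum.inr (Fin.castSucc x)) * w (Fin.castSucc x) by
            rw [hB₁ne (Sum.inl r) (Sum.inr x) Sum.inr_ne_inl]; simp [he]]
      simp only [he, dagPeel_inl_inl, hb]
      ring
    · rw [hB₁ne _ _ (fun h => hc (Sum.inl_injective h))]
      simp [he]

end Dag

/-! ### The tournament gadget on one slot -/

section Slot

variable {V : Type*} [Fintype V] [DecidableEq V]

/-- **The tournament gadget** attached to the slot `(u, v)` of `A`: `K` new nodes, of which the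
first `act` are active; the active nodes carry the transitive tournament (an edge `x → x'` of
weight `1` for all active `x < x'`), every new node has a self-loop of weight `1`, node `0` is
entered from `u` (if active) and every active node leaves to `v`; all weights are `0/1` apart
from those of `A`. [cite: Papadimitriou1994, Thm. 18.3 (proof)] -/
def slotGadget (A : Matrix V V R) (u v : V) (K act : ℕ) : Matrix (V ⊕ Fin K) (V ⊕ Fin K) R :=
  fun i j => match i, j with
  | Sum.inl r, Sum.inl c => A r c
  | Sum.inl r, Sum.inr x => if r = u ∧ (x : ℕ) = 0 ∧ 0 < act then 1 else 0
  | Sum.inr x, Sum.inl c => if c = v ∧ (x : ℕ) < act then 1 else 0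
  | Sum.inr x, Sum.inr x' => if x = x' then 1 else if x < x' ∧ (x' : ℕ) < act then 1 else 0

/-- **The tournament gadget adds `2^(act-1)` to the slot**: for `act ≤ K`,
`per (slotGadget A u v K act) = per (A with A u v ↦ A u v + slotWeight act)` (`slotWeight act =
2^(act-1)`, or `0` when `act = 0`): the `2^(act-1)` increasing paths through the active nodes
from node `0` to `v` replace the edge `(u, v)`, all unused new nodes sit on their self-loops.
(Papadimitriou 1994, proof of Thm. 18.3: an edge of weight `2^k` is simulated by a chain of `k`
doubling gadgets; Valiant 1979, Lemma 3.3.) [cite: Papadimitriou1994, Thm. 18.3 (proof)] -/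
theorem permanent_slotGadget (A : Matrix V V R) (u v : V) {K act : ℕ} (hact : act ≤ K) :
    (slotGadget A u v K act).permanent =
      (A.updateCol v (fun r => A r v + if r = u then slotWeight R act else 0)).permanent := by
  rw [permanent_dag K (slotGadget A u v K act) v (slotW R act)
    (fun x => by simp [slotGadget])
    (fun x x' hx => by
      have h1 : x ≠ x' := ne_of_gt hx
      have h2 : ¬ (x < x') := not_lt_of_gt hx
      simp [slotGadget, h1, h2])
    (fun x c hc => by simp [slotGadget, hc])
    (fun x => by
      by_cases hx : (x : ℕ) < act
      · simp only [slotW, if_pos hx, slotGadget, true_and]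
        rw [← sum_slotW_add_one (R := R) hact x hx, add_comm]
        congr 1
        refine Finset.sum_congr rfl fun x' _ => ?_
        by_cases h : x < x' ∧ (x' : ℕ) < act
        · have hne : x ≠ x' := ne_of_lt h.1
          rw [if_pos h, if_pos h.1, if_neg hne, if_pos h, if_pos h.2, one_mul]
        · rw [if_neg h]
          by_cases h' : x < x'
          · have h'' : ¬ (x' : ℕ) < act := fun hh => h ⟨h', hh⟩
            rw [if_pos h', if_neg (ne_of_lt h'), if_neg h, if_neg h'', mul_zero]
          · rw [if_neg h']
      · simp only [slotW, if_neg hx, slotGadget]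
        rw [if_neg (fun h => hx h.2), zero_add]
        symm
        refine Finset.sum_eq_zero fun x' _ => ?_
        by_cases h' : x < x'
        · have h'' : ¬ ((x' : ℕ) < act) := fun hh => hx (lt_trans (Fin.lt_def.1 h') hh)
          simp [h'']
        · rw [if_neg h'])]
  congr 1
  ext r c
  simp only [submatrix_apply, slotGadget, updateCol_apply]
  split_ifs with hc hr
  · subst hc; subst hr
    congr 1
    by_cases hact0 : act = 0
    · subst hact0
      simp [slotWeight]
    · have hK : 0 < K := by omega
      rw [Finset.sum_eq_single (⟨0, hK⟩ : Fin K)]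
      · simp [slotW, slotWeight, hact0, Nat.pos_of_ne_zero hact0]
      · intro x _ hx
        have : (x : ℕ) ≠ 0 := fun h => hx (Fin.ext h)
        simp [this]
      · simp
  · subst hc
    congr 1
    exact Finset.sum_eq_zero fun x _ => by simp [hr]
  · rfl

end Slot

/-! ### Many slots at once -/

section MultiSlot

variable {V : Type*} [Fintype V] [DecidableEq V]

/-- **All gadgets at once**: `k` slots, each with `K` private new nodes carrying its tournament
gadget (`slotGadget` pattern), no edges between different gadgets. [cite: Valiant1979, Lemma 3.3] -/
def multiSlot (A : Matrix V V R) {k : ℕ} (K : ℕ) (S : Fin k → Slot V) :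
    Matrix (V ⊕ Fin k × Fin K) (V ⊕ Fin k × Fin K) R :=
  fun i j => match i, j with
  | Sum.inl r, Sum.inl c => A r c
  | Sum.inl r, Sum.inr (s, x) => if r = (S s).u ∧ (x : ℕ) = 0 ∧ 0 < (S s).act then 1 else 0
  | Sum.inr (s, x), Sum.inl c => if c = (S s).v ∧ (x : ℕ) < (S s).act then 1 else 0
  | Sum.inr (s, x), Sum.inr (s', x') =>
      if s = s' then (if x = x' then 1 else if x < x' ∧ (x' : ℕ) < (S s).act then 1 else 0) else 0

/-- The matrix the gadgets simulate: `A` with `slotWeight (act_s)` added at `(u_s, v_s)` for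
every slot `s`. [cite: Valiant1979, Lemma 3.3] -/
def addSlots (A : Matrix V V R) {k : ℕ} (S : Fin k → Slot V) : Matrix V V R :=
  fun r c => A r c + ∑ s, if r = (S s).u ∧ c = (S s).v then slotWeight R (S s).act else 0

omit [Fintype V] in
/-- Peeling the last slot: after re-indexing, `multiSlot A K S` is the tournament gadget of the last
slot attached to `multiSlot A K (S ∘ castSucc)`. [folklore] -/
theorem multiSlot_submatrix_slotPeel (A : Matrix V V R) {k : ℕ} (K : ℕ) (S : Fin (k + 1) → Slot V) :
    (multiSlot A K S).submatrix (slotPeel V k K) (slotPeel V k K) =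
      slotGadget (multiSlot A K (fun s => S (Fin.castSucc s))) (Sum.inl (S (Fin.last k)).u)
        (Sum.inl (S (Fin.last k)).v) K (S (Fin.last k)).act := by
  ext i j
  rcases i with (r | ⟨s, x⟩) | x <;> rcases j with (c | ⟨s', x'⟩) | x'
  · rfl
  · rfl
  · simp [multiSlot, slotGadget]
  · rfl
  · simp only [submatrix_apply, slotPeel_inl_inr, multiSlot, slotGadget, Fin.castSucc_inj]
  · simp [multiSlot, slotGadget, (Fin.castSucc_lt_last s).ne]
  · simp [multiSlot, slotGadget]
  · simp [multiSlot, slotGadget, (Fin.castSucc_lt_last s').ne']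
  · simp [multiSlot, slotGadget]

/-- **All gadgets at once preserve the simulated permanent**: for slots with `act_s ≤ K`,
`per (multiSlot A K S) = per (A + ∑_s slotWeight (act_s) · E_{u_s v_s})` (peel the slots one at
a time with `permanent_slotGadget`). This is Valiant's Lemma 3.3 ("`Perm A = Perm h(A)`") for the
tournament gadgets. [cite: Valiant1979, Lemma 3.3] -/
theorem permanent_multiSlot (A : Matrix V V R) (K : ℕ) :
    ∀ {k : ℕ} (S : Fin k → Slot V), (∀ s, (S s).act ≤ K) →
      (multiSlot A K S).permanent = (addSlots A S).permanent
  | 0, S, _ => by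
    rw [← permanent_submatrix_equiv (Equiv.sumEmpty V (Fin 0 × Fin K)).symm]
    congr 1
    ext r c
    simp [multiSlot, addSlots]
  | k + 1, S, hS => by
    rw [← permanent_submatrix_equiv (slotPeel V k K), multiSlot_submatrix_slotPeel,
      permanent_slotGadget _ _ _ (hS (Fin.last k))]
    have key : (multiSlot A K (fun s => S (Fin.castSucc s))).updateCol (Sum.inl (S (Fin.last k)).v)
        (fun i => multiSlot A K (fun s => S (Fin.castSucc s)) i (Sum.inl (S (Fin.last k)).v) +
          if i = Sum.inl (S (Fin.last k)).u then slotWeight R (S (Fin.last k)).act else 0) =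
        multiSlot (A.updateCol (S (Fin.last k)).v (fun r => A r (S (Fin.last k)).v +
          if r = (S (Fin.last k)).u then slotWeight R (S (Fin.last k)).act else 0)) K
          (fun s => S (Fin.castSucc s)) := by
      ext i j
      rcases i with r | ⟨s, x⟩ <;> rcases j with c | ⟨s', x'⟩
      · simp [updateCol_apply, multiSlot]
      · simp [multiSlot]
      · by_cases hc : c = (S (Fin.last k)).v
        · subst hc
          simp [multiSlot]
        · rw [updateCol_ne (fun h => hc (Sum.inl_injective h))]
          simp [multiSlot]
      · simp [multiSlot]
    rw [key, permanent_multiSlot _ K (fun s => S (Fin.castSucc s)) (fun s => hS _)]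
    congr 1
    ext r c
    simp only [addSlots, updateCol_apply, Fin.sum_univ_castSucc]
    by_cases hc : c = (S (Fin.last k)).v
    · subst hc
      by_cases hr : r = (S (Fin.last k)).u
      · rw [if_pos rfl, if_pos hr, if_pos ⟨hr, rfl⟩]; ring
      · rw [if_pos rfl, if_neg hr, if_neg (fun h => hr h.1)]; ring
    · have : ¬ (r = (S (Fin.last k)).u ∧ c = (S (Fin.last k)).v) := fun h => hc h.2
      rw [if_neg hc, if_neg this]; ring

end MultiSlot

end Matrix
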